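import Literature.Topology.FourManifolds.DiscFilling
import Literature.Topology.FourManifolds.SliceCharts
import Literature.Topology.FourManifolds.ClosedBallProofs
import Literature.Geometry.Manifold.ModelChange
import HarnessLib

/-!
# Boundaryless manifolds as half-space charted manifolds: the identity is a smooth embedding

Topic `Literature/Topology/FourManifolds`; general infrastructure (fact seat `provefact-…` of
`Literature.Topology.FourManifolds.HomotopySphere.exists_highlyConnected_of_mem_signatureSet`,
Kosinski's surgery below the middle dimension, X.2.2, on a manifold **with** boundary).

`ClosedAsCobordism.lean` equips a manifold `X` charted on `ℝⁿ⁺¹` (model `𝓡 (n + 1)`, no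
boundary) with the synonym `HalfSpaceCharted X` charted on the closed half-space
`EuclideanHalfSpace (n + 1)` (model `𝓡∂ (n + 1)`), by following every chart with
`expFirst : (t, u) ↦ (eᵗ, u)`; it is a `C^∞` manifold with empty boundary, and the identity
`of : X ≃ HalfSpaceCharted X` is `C^∞` in both directions (`HalfSpaceCharted.contMDiff_of`,
`HalfSpaceCharted.contMDiff_of_symm`, `DiscFilling.lean`).  To glue a boundaryless piece — e.g. the
new handle `OD^{k+1} × Sˡ` of a surgery, which comes charted on a *product* model — into a
manifold with boundary by the tree's gluing of half-space charted pieces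
(`GluingConstructionBoundary.lean`, both pieces on `𝓡∂ (n + 1)`, smooth embeddings composed with
`inr` stay smooth embeddings), one needs the identity as a **smooth embedding of manifolds**
(Mathlib's `Manifold.IsSmoothEmbedding`: an immersion in the chart sense and a topological
embedding).  This file proves:

* `HalfSpaceCharted.isImmersionAtOfComplement_of`, `HalfSpaceCharted.isSmoothEmbedding_of` — for
  `X` charted on `ℝⁿ⁺¹`, `of : X → HalfSpaceCharted X` is a `C^∞` immersion at every point
  (complement `PUnit`) and a `C^∞` embedding `𝓡 (n + 1) → 𝓡∂ (n + 1)`: in the chart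
  `chartAt x ≫ expFirst` of `X` (a chart followed by a partial diffeomorphism of the model vector
  space, hence in the maximal atlas) and the preferred half-space chart `chartAt x ≫ emb` of the
  synonym, `of` reads as the identity of an open subset of `ℝⁿ⁺¹`;
* `HalfSpaceCharted.isImmersionAtOfComplement_of_into`,
  `HalfSpaceCharted.isSmoothEmbedding_of_into`, `HalfSpaceCharted.contMDiff_of_into`,
  `HalfSpaceCharted.contMDiff_out_of_symm` — the same for an arbitrary **boundaryless** `C^∞`
  manifold `Y` with model `I` on `(E, H)` and a change of model `f : H ≃ₜ ℝⁿ⁺¹`, `f = L ∘ I` for a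
  linear isomorphism `L : E ≃L ℝⁿ⁺¹` (e.g. a product of Euclidean models of total dimension
  `n + 1`): the identity `Y → HalfSpaceCharted (Rechart f Y)` onto the synonym of
  `Literature.Geometry.Manifold.Rechart f Y` (`ModelChange.lean`) is a `C^∞` embedding
  `I → 𝓡∂ (n + 1)` with `C^∞` inverse.  The domain chart is `chartAt y` followed by the
  `I`-conjugate (`OpenPartialHomeomorph.conjModel`, `SliceCharts.lean`) of the partial
  diffeomorphism `L⁻¹ ∘ expFirst ∘ L` of `E`.

Lee, *Introduction to Smooth Manifolds* (2013), Ch. 1 (Prop. 1.17: compatible atlases determine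
the same smooth structure; Thm. 1.46) — here pure bookkeeping for Mathlib's formalism, in which
the model space is an `outParam` of `ChartedSpace`.  Everything is proved; no definitions, no
named facts.
-/

open scoped Manifold ContDiff Topology
open Set Function

noncomputable section

namespace Literature.Topology.FourManifolds

universe u

namespace HalfSpaceCharted

section Self

variable {X : Type u}

/-- The identity `of : X → HalfSpaceCharted X` is an open embedding (it is a homeomorphism: the
synonym carries the topology of `X`). [folklore] -/
theorem isOpenEmbedding_of [TopologicalSpace X] :
    Topology.IsOpenEmbedding (of : X → HalfSpaceCharted X) :=
  Topology.IsOpenEmbedding.id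

variable {n : ℕ} [TopologicalSpace X] [ChartedSpace (EuclideanSpace ℝ (Fin (n + 1))) X]

/-- A `C^∞` map `g` into `X` gives the `C^∞` map `of ∘ g` into `HalfSpaceCharted X`. [folklore] -/
theorem contMDiff_of_comp {E' H' : Type*} [NormedAddCommGroup E'] [NormedSpace ℝ E']
    [TopologicalSpace H'] {I' : ModelWithCorners ℝ E' H'} {Q : Type*} [TopologicalSpace Q]
    [ChartedSpace H' Q] {g : Q → X} (hg : ContMDiff I' (𝓡 (n + 1)) ∞ g) :
    ContMDiff I' (𝓡∂ (n + 1)) ∞ (of ∘ g : Q → HalfSpaceCharted X) :=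
  (contMDiff_of (n := n)).comp hg

/-- A `C^∞` map into `X` on a set, followed by `of`, is `C^∞` on that set into
`HalfSpaceCharted X`. [folklore] -/
theorem contMDiffOn_of_comp {E' H' : Type*} [NormedAddCommGroup E'] [NormedSpace ℝ E']
    [TopologicalSpace H'] {I' : ModelWithCorners ℝ E' H'} {Q : Type*} [TopologicalSpace Q]
    [ChartedSpace H' Q] {g : Q → X} {s : Set Q} (hg : ContMDiffOn I' (𝓡 (n + 1)) ∞ g s) :
    ContMDiffOn I' (𝓡∂ (n + 1)) ∞ (of ∘ g : Q → HalfSpaceCharted X) s :=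
  (contMDiff_of (n := n)).comp_contMDiffOn hg

/-- A map out of `HalfSpaceCharted X` which is `C^∞` out of `X` on a set is `C^∞` on the
corresponding set. [folklore] -/
theorem contMDiffOn_comp_of_symm {E' H' : Type*} [NormedAddCommGroup E']
    [NormedSpace ℝ E'] [TopologicalSpace H'] {I' : ModelWithCorners ℝ E' H'} {Q : Type*}
    [TopologicalSpace Q] [ChartedSpace H' Q] {g : X → Q} {s : Set X}
    (hg : ContMDiffOn (𝓡 (n + 1)) I' ∞ g s) :
    ContMDiffOn (𝓡∂ (n + 1)) I' ∞ (g ∘ of.symm : HalfSpaceCharted X → Q) (of.symm ⁻¹' s) :=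
  hg.comp (contMDiff_of_symm (n := n)).contMDiffOn fun _ hy ↦ hy

variable [IsManifold (𝓡 (n + 1)) ∞ X]

/-- **The identity `X → HalfSpaceCharted X` is a `C^∞` immersion at every point** (models
`𝓡 (n + 1)` and `𝓡∂ (n + 1)`, complement `PUnit`): in the chart `chartAt x ≫ expFirst` of `X`
(valued in the open half-space; it lies in the maximal atlas of `X`, being a chart followed by a
partial diffeomorphism of the model vector space) and the preferred half-space chart
`chartAt x ≫ emb` of the synonym, both read through their models with corners, `of` is the
identity of an open subset of `ℝⁿ⁺¹`. [folklore] -/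
theorem isImmersionAtOfComplement_of (x : X) :
    Manifold.IsImmersionAtOfComplement PUnit.{1} (𝓡 (n + 1)) (𝓡∂ (n + 1)) ∞
      (of : X → HalfSpaceCharted X) x := by
  -- `expFirst` as a partial diffeomorphism of `ℝⁿ⁺¹` onto the open half-space
  let D : OpenPartialHomeomorph (EuclideanSpace ℝ (Fin (n + 1)))
      (EuclideanSpace ℝ (Fin (n + 1))) :=
    { toFun := expFirst n
      invFun := logFirst n
      source := univ
      target := {u | 0 < u 0}
      map_source' := fun u _ ↦ expFirst_apply_zero_pos n u
      map_target' := fun _ _ ↦ mem_univ _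
      left_inv' := fun u _ ↦ logFirst_expFirst n u
      right_inv' := fun _ hu ↦ expFirst_logFirst n hu
      open_source := isOpen_univ
      open_target := isOpen_setOf_apply_zero_pos n
      continuousOn_toFun := (continuous_expFirst n).continuousOn
      continuousOn_invFun := continuousOn_logFirst n }
  set c := chartAt (EuclideanSpace ℝ (Fin (n + 1))) x with hc
  have hsrc : (c ≫ₕ D).source = c.source := by
    rw [OpenPartialHomeomorph.trans_source]
    exact inter_eq_left.2 fun y _ ↦ mem_univ _
  have hmax : c ≫ₕ D ∈ IsManifold.maximalAtlas (𝓡 (n + 1)) ∞ X :=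
    trans_mem_maximalAtlas_of_contDiffOn (IsManifold.chart_mem_maximalAtlas x) D
      (contDiff_expFirst n).contDiffOn (contDiffOn_logFirst n)
  refine Manifold.IsImmersionAtOfComplement.mk_of_charts
    (ContinuousLinearEquiv.prodUnique ℝ (EuclideanSpace ℝ (Fin (n + 1))) PUnit.{1}) (c ≫ₕ D)
    (chartAt (EuclideanHalfSpace (n + 1)) (of x)) ?_ (mem_chart_source _ _)
    hmax (IsManifold.chart_mem_maximalAtlas _) ?_ ?_
  · rw [hsrc]
    exact mem_chart_source _ x
  · intro y hy
    rw [hsrc] at hy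
    show y ∈ (c.trans (emb n)).source
    simpa using hy
  · intro u hu
    rw [OpenPartialHomeomorph.extend_target, modelWithCornersSelf_coe_symm, preimage_id_eq, id_eq,
      ModelWithCorners.range_eq_univ, inter_univ, OpenPartialHomeomorph.trans_target] at hu
    obtain ⟨hu0, huc⟩ := hu
    change 0 < u 0 at hu0
    change logFirst n u ∈ c.target at huc
    simp only [comp_apply, OpenPartialHomeomorph.extend_coe, OpenPartialHomeomorph.extend_coe_symm,
      modelWithCornersSelf_coe_symm, id_eq, ContinuousLinearEquiv.prodUnique_apply]
    show ((c ≫ₕ emb n) (c.symm (logFirst n u))).val = u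
    rw [OpenPartialHomeomorph.coe_trans, comp_apply, emb_apply_val, c.right_inv huc,
      expFirst_logFirst n hu0]

/-- **The identity `of : X → HalfSpaceCharted X` is a `C^∞` embedding** from the boundaryless
structure (`𝓡 (n + 1)`) to the half-space structure (`𝓡∂ (n + 1)`). [folklore] -/
theorem isSmoothEmbedding_of :
    Manifold.IsSmoothEmbedding (𝓡 (n + 1)) (𝓡∂ (n + 1)) ∞ (of : X → HalfSpaceCharted X) :=
  ⟨Manifold.IsImmersionOfComplement.isImmersion fun x ↦ isImmersionAtOfComplement_of (n := n) x,
    Topology.IsEmbedding.id⟩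

end Self

/-! ### An arbitrary boundaryless manifold, recharted on `ℝⁿ⁺¹` and then on the half-space -/

section Rechart

open Literature.Geometry.Manifold

variable {n : ℕ} {E H : Type*} [NormedAddCommGroup E] [NormedSpace ℝ E] [TopologicalSpace H]
  {I : ModelWithCorners ℝ E H} [I.Boundaryless]
  {Y : Type u} [TopologicalSpace Y] [ChartedSpace H Y] [IsManifold I ∞ Y]
  (f : H ≃ₜ EuclideanSpace ℝ (Fin (n + 1))) (L : E ≃L[ℝ] EuclideanSpace ℝ (Fin (n + 1)))
  (hf : ∀ x, f x = L (I x))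

include hf

/-- **The identity `Y → HalfSpaceCharted (Rechart f Y)` is a `C^∞` immersion at every point**
(models `I` and `𝓡∂ (n + 1)`, complement `PUnit`), for a boundaryless `C^∞` manifold `Y` and a
change of model `f = L ∘ I : H ≃ₜ ℝⁿ⁺¹`.  Domain chart: `chartAt y` followed by the `I`-conjugate
of the partial diffeomorphism `L⁻¹ ∘ expFirst ∘ L` of `E` (an element of `contDiffGroupoid ∞ I`,
so the composite is in the maximal atlas); codomain chart: the preferred chart
`(chartAt y ≫ f) ≫ emb` of the synonym; in these, read through the models, the identity is the
linear isomorphism `L`. [folklore] -/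
theorem isImmersionAtOfComplement_of_into (y : Y) :
    haveI := Rechart.isManifold (n := ∞) f Y (Rechart.contMDiff_of_apply_eq_linear f L hf)
      (Rechart.contMDiff_symm_of_apply_eq_linear f L hf)
    Manifold.IsImmersionAtOfComplement PUnit.{1} I (𝓡∂ (n + 1)) ∞
      (of ∘ Rechart.into f Y : Y → HalfSpaceCharted (Rechart f Y)) y := by
  haveI := Rechart.isManifold (n := ∞) f Y (Rechart.contMDiff_of_apply_eq_linear f L hf)
    (Rechart.contMDiff_symm_of_apply_eq_linear f L hf)
  -- `L⁻¹ ∘ expFirst ∘ L` as a partial diffeomorphism of `E`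
  let G : OpenPartialHomeomorph E E :=
    { toFun := fun v ↦ L.symm (expFirst n (L v))
      invFun := fun v ↦ L.symm (logFirst n (L v))
      source := univ
      target := {v | 0 < L v 0}
      map_source' := fun v _ ↦ by
        show 0 < L (L.symm (expFirst n (L v))) 0
        rw [L.apply_symm_apply]; exact expFirst_apply_zero_pos n _
      map_target' := fun _ _ ↦ mem_univ _
      left_inv' := fun v _ ↦ by
        show L.symm (logFirst n (L (L.symm (expFirst n (L v))))) = v
        rw [L.apply_symm_apply, logFirst_expFirst, L.symm_apply_apply]
      right_inv' := fun v hv ↦ by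
        show L.symm (expFirst n (L (L.symm (logFirst n (L v))))) = v
        rw [L.apply_symm_apply, expFirst_logFirst n hv, L.symm_apply_apply]
      open_source := isOpen_univ
      open_target := (isOpen_setOf_apply_zero_pos n).preimage L.continuous
      continuousOn_toFun :=
        (L.symm.continuous.comp ((continuous_expFirst n).comp L.continuous)).continuousOn
      continuousOn_invFun := L.symm.continuous.comp_continuousOn
        ((continuousOn_logFirst n).comp L.continuous.continuousOn fun _ hv ↦ hv) }
  have hG : ContDiffOn ℝ ∞ G G.source :=
    (L.symm.contDiff.comp ((contDiff_expFirst n).comp L.contDiff)).contDiffOn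
  have hG' : ContDiffOn ℝ ∞ G.symm G.target := by
    refine L.symm.contDiff.comp_contDiffOn ((contDiffOn_logFirst n).comp L.contDiff.contDiffOn ?_)
    exact fun v hv ↦ hv
  have hK : G.conjModel I ∈ contDiffGroupoid ∞ I :=
    OpenPartialHomeomorph.conjModel_mem_contDiffGroupoid hG hG'
  have hKsrc : (G.conjModel I).source = univ := by
    rw [OpenPartialHomeomorph.conjModel_source, ModelWithCorners.range_eq_univ, interior_univ]
    simp [G]
  set c := chartAt H y with hc
  have hsrc : (c ≫ₕ G.conjModel I).source = c.source := by
    rw [OpenPartialHomeomorph.trans_source, hKsrc, preimage_univ, inter_univ]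
  have hmax : c ≫ₕ G.conjModel I ∈ IsManifold.maximalAtlas I ∞ Y :=
    StructureGroupoid.trans_mem_maximalAtlas _ (IsManifold.chart_mem_maximalAtlas y) hK
  refine Manifold.IsImmersionAtOfComplement.mk_of_charts
    ((ContinuousLinearEquiv.prodUnique ℝ E PUnit.{1}).trans L) (c ≫ₕ G.conjModel I)
    (chartAt (EuclideanHalfSpace (n + 1)) ((of ∘ Rechart.into f Y) y)) ?_
    (mem_chart_source _ _) hmax (IsManifold.chart_mem_maximalAtlas _) ?_ ?_
  · rw [hsrc]
    exact mem_chart_source H y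
  · intro z hz
    rw [hsrc] at hz
    rw [mem_preimage, chartAt_eq, OpenPartialHomeomorph.trans_source, emb_source, preimage_univ,
      inter_univ]
    show Rechart.into f Y z ∈ (chartAt (EuclideanSpace ℝ (Fin (n + 1))) (Rechart.into f Y y)).source
    rw [Rechart.chartAt_def, Rechart.chart_source]
    exact hz
  · intro u hu
    rw [OpenPartialHomeomorph.extend_target, ModelWithCorners.range_eq_univ, inter_univ,
      mem_preimage, OpenPartialHomeomorph.trans_target, mem_inter_iff, mem_preimage,
      OpenPartialHomeomorph.conjModel_target, OpenPartialHomeomorph.conjModel_symm_apply] at hu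
    obtain ⟨hu1, hu2⟩ := hu
    rw [mem_preimage, I.right_inv (I.range_eq_univ.symm ▸ mem_univ u)] at hu1
    rw [I.right_inv (I.range_eq_univ.symm ▸ mem_univ u)] at hu2
    obtain ⟨-, hut, -⟩ := hu1
    change 0 < L u 0 at hut
    simp only [comp_apply, OpenPartialHomeomorph.extend_coe, OpenPartialHomeomorph.extend_coe_symm,
      ContinuousLinearEquiv.trans_apply, ContinuousLinearEquiv.prodUnique_apply,
      OpenPartialHomeomorph.coe_trans_symm, OpenPartialHomeomorph.conjModel_symm_apply]
    rw [I.right_inv (I.range_eq_univ.symm ▸ mem_univ u)]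
    show (((chartAt (EuclideanSpace ℝ (Fin (n + 1))) (Rechart.into f Y y)).trans (emb n))
      (Rechart.into f Y (c.symm (I.symm (G.symm u))))).val = L u
    rw [OpenPartialHomeomorph.coe_trans, comp_apply, emb_apply_val, Rechart.chartAt_def,
      Rechart.out_into, Rechart.chart_apply, Rechart.out_into, ← hc, c.right_inv hu2, hf,
      I.right_inv (I.range_eq_univ.symm ▸ mem_univ _)]
    show expFirst n (L (L.symm (logFirst n (L u)))) = L u
    rw [L.apply_symm_apply, expFirst_logFirst n hut]

/-- **The identity `Y → HalfSpaceCharted (Rechart f Y)` is a `C^∞` embedding** `I → 𝓡∂ (n + 1)`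
(boundaryless `Y`, change of model `f = L ∘ I`). [folklore] -/
theorem isSmoothEmbedding_of_into :
    haveI := Rechart.isManifold (n := ∞) f Y (Rechart.contMDiff_of_apply_eq_linear f L hf)
      (Rechart.contMDiff_symm_of_apply_eq_linear f L hf)
    Manifold.IsSmoothEmbedding I (𝓡∂ (n + 1)) ∞
      (of ∘ Rechart.into f Y : Y → HalfSpaceCharted (Rechart f Y)) :=
  ⟨Manifold.IsImmersionOfComplement.isImmersion fun y ↦
      isImmersionAtOfComplement_of_into f L hf y,
    Topology.IsEmbedding.id⟩

/-- The identity `Y → HalfSpaceCharted (Rechart f Y)` is `C^∞` (`I → 𝓡∂ (n + 1)`). [folklore] -/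
theorem contMDiff_of_into :
    haveI := Rechart.isManifold (n := ∞) f Y (Rechart.contMDiff_of_apply_eq_linear f L hf)
      (Rechart.contMDiff_symm_of_apply_eq_linear f L hf)
    ContMDiff I (𝓡∂ (n + 1)) ∞ (of ∘ Rechart.into f Y : Y → HalfSpaceCharted (Rechart f Y)) :=
  (isSmoothEmbedding_of_into f L hf).contMDiff

omit [I.Boundaryless] in
/-- The identity `HalfSpaceCharted (Rechart f Y) → Y` is `C^∞` (`𝓡∂ (n + 1) → I`): the composite
of `of.symm` (`HalfSpaceCharted.contMDiff_of_symm`) and `Rechart.out` (`Rechart.contMDiff_out`).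
[folklore] -/
theorem contMDiff_out_of_symm :
    haveI := Rechart.isManifold (n := ∞) f Y (Rechart.contMDiff_of_apply_eq_linear f L hf)
      (Rechart.contMDiff_symm_of_apply_eq_linear f L hf)
    ContMDiff (𝓡∂ (n + 1)) I ∞
      (Rechart.out f Y ∘ of.symm : HalfSpaceCharted (Rechart f Y) → Y) :=
  haveI := Rechart.isManifold (n := ∞) f Y (Rechart.contMDiff_of_apply_eq_linear f L hf)
    (Rechart.contMDiff_symm_of_apply_eq_linear f L hf)
  (Rechart.contMDiff_out (n := ∞) f Y (Rechart.contMDiff_of_apply_eq_linear f L hf)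
    (Rechart.contMDiff_symm_of_apply_eq_linear f L hf)).comp (contMDiff_of_symm (n := n))

omit [TopologicalSpace Y] [ChartedSpace H Y] [I.Boundaryless] [IsManifold I ∞ Y] hf in
/-- The identity `Y → HalfSpaceCharted (Rechart f Y)` is onto. [folklore] -/
@[simp] theorem range_of_into :
    range (of ∘ Rechart.into f Y : Y → HalfSpaceCharted (Rechart f Y)) = univ :=
  eq_univ_of_forall fun z ↦ ⟨Rechart.out f Y (of.symm z), rfl⟩

omit [I.Boundaryless] [IsManifold I ∞ Y] [ChartedSpace H Y] hf in
/-- The identity `Y → HalfSpaceCharted (Rechart f Y)` is an open embedding (a homeomorphism).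
[folklore] -/
theorem isOpenEmbedding_of_into :
    Topology.IsOpenEmbedding (of ∘ Rechart.into f Y : Y → HalfSpaceCharted (Rechart f Y)) :=
  Topology.IsOpenEmbedding.id

end Rechart

end HalfSpaceCharted

end Literature.Topology.FourManifolds
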